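import Summits.NavierStokesRegularity.TurbBounds.PieceAssembly
import HarnessLib

/-!
# Row-batched sparse assembly — WELL-FORMEDNESS of the piece data and the SEMANTICS of densified rows

Companion of `PieceAssembly.lean` (pub-turb-shear gen 5, 2026-08-21; referee advisory INBOX l.307): the `scatterRow` walk silently
skips out-of-order columns, so the meaning of `densify`/`pieceSum` as "the sparse matrices of the data" needs the column lists to be
strictly increasing. Here: Boolean tests `strictIncr`, `rowWF`, `piecesWF` (checked per mode by `decide +kernel` in every
`Certs/<Row>/EvalBlock<m>.lean` as `pieces_wf`), the listed-value function `lookupVal`, and the THEOREMS `getD_scatter_zero`,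
`getD_densifyRow`, `matrixOfRows_densify_apply`: with strictly increasing columns nothing is dropped — entry `(i, j)` of a densified
piece is exactly the value listed for column `j` in sparse row `i`, else `0`.
HONEST FRAMING: rigorous bounds for the stated PDE and boundary conditions; no claim about physical turbulence beyond the bound.
-/

namespace Summit.NavierStokesRegularity.TurbBounds.PieceAssembly

open Literature.Computation.Certificates

/-! ### Well-formedness of sparse piece data (referee advisory 2026-08-21T21:53Z) -/

/-- Strictly increasing list of naturals (Boolean test). -/
def strictIncr : List ℕ → Bool
  | [] => true
  | [_] => true
  | a :: b :: t => decide (a < b) && strictIncr (b :: t)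

/-- A sparse row is WELL-FORMED for width `n` when its column list is strictly increasing, every column is `< n`, and it has as
many values as columns. Under this condition the `scatterRow` walk consumes EVERY listed entry (nothing is dropped), so
`densifyRow n js vs` is the row with `v_k` at column `j_k` and `0` elsewhere — see `getD_densifyRow_of_wf`. -/
def rowWF (n : ℕ) (js : List ℕ) (vs : List ℚ) : Bool :=
  (js.length == vs.length) && js.all (· < n) && strictIncr js



/-- All pieces well-formed: `n` column rows, `n` value rows, and every row `rowWF`. (Checked per mode by `decide +kernel` in the
EvalBlock files, so the kernel — not only the producer's and the referee's Python — carries the well-formedness of the literal data.) -/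
def piecesWF (n : ℕ) (ps : List (ℚ × List (List ℕ) × List (List ℚ))) : Bool :=
  ps.all fun p => (p.2.1.length == n) && (p.2.2.length == n) && (List.zipWith (rowWF n) p.2.1 p.2.2).all id

/-- Test. -/
example : piecesWF 3 [(2, [[0, 2], [], [1]], [[1, 5], [], [7]])] = true := by decide +kernel
/-- Test (a decreasing column list is rejected). -/
example : piecesWF 3 [(2, [[2, 0], [], [1]], [[1, 5], [], [7]])] = false := by decide +kernel

/-! ### Semantics of the densified rows under well-formedness (referee advisory: the walk drops nothing) -/

/-- The value listed for column `k` in a sparse row (first match), `0` if none. -/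
def lookupVal : List ℕ → List ℚ → ℕ → ℚ
  | j :: js, v :: vs, k => if j = k then v else lookupVal js vs k
  | _, _, _ => 0

/-- No listed column equals `k` if all are `> k`. -/
theorem lookupVal_eq_zero_of_lt : ∀ (js : List ℕ) (vs : List ℚ) (k : ℕ), (∀ x ∈ js, k < x) → lookupVal js vs k = 0
  | [], vs, k, _ => by cases vs <;> rfl
  | j :: js, [], k, _ => rfl
  | j :: js, v :: vs, k, h => by
      have hj : k < j := h j (by simp)
      simp only [lookupVal, show (j = k) ↔ False from ⟨fun e => absurd e (by omega), False.elim⟩, if_false]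
      exact lookupVal_eq_zero_of_lt js vs k (fun x hx => h x (by simp [hx]))

/-- Unfolding `strictIncr` on two heads. -/
theorem strictIncr_cons_cons {a b : ℕ} {t : List ℕ} (h : strictIncr (a :: b :: t) = true) :
    a < b ∧ strictIncr (b :: t) = true := by
  simpa [strictIncr] using h

/-- In a strictly increasing list every tail element exceeds the head. -/
theorem lt_of_strictIncr_cons : ∀ (a : ℕ) (t : List ℕ), strictIncr (a :: t) = true → ∀ x ∈ t, a < x
  | a, [], _, x, hx => by simp at hx
  | a, b :: t, h, x, hx => by
      obtain ⟨hab, ht⟩ := strictIncr_cons_cons h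
      rcases List.mem_cons.mp hx with rfl | hx'
      · exact hab
      · exact lt_trans hab (lt_of_strictIncr_cons b t ht x hx')

/-- The tail of a strictly increasing list is strictly increasing. -/
theorem strictIncr_tail {a : ℕ} {t : List ℕ} (h : strictIncr (a :: t) = true) : strictIncr t = true := by
  cases t with
  | nil => rfl
  | cons b t => exact (strictIncr_cons_cons h).2

/-- **The walk from zeros drops nothing** (columns strictly increasing and `≥ pos`): entry `k < len` of
`scatterRow 1 (replicate len 0) js vs pos` is the listed value for column `pos + k` (or `0`). -/
theorem getD_scatter_zero : ∀ (len : ℕ) (js : List ℕ) (vs : List ℚ) (pos k : ℕ),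
    strictIncr js = true → (∀ x ∈ js, pos ≤ x) → k < len →
      (scatterRow 1 (List.replicate len 0) js vs pos).getD k 0 = lookupVal js vs (pos + k)
  | 0, js, vs, pos, k, _, _, hk => absurd hk (Nat.not_lt_zero k)
  | len + 1, [], vs, pos, k, _, _, hk => by
      have : scatterRow 1 (List.replicate (len + 1) (0 : ℚ)) [] vs pos = List.replicate (len + 1) 0 := by
        cases vs <;> rfl
      rw [this]
      have h1 : (List.replicate (len + 1) (0 : ℚ)).getD k 0 = 0 := by
        simp [List.getD_eq_getElem?_getD]
      rw [h1]; cases vs <;> rfl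
  | len + 1, j :: js, [], pos, k, _, _, hk => by
      show (List.replicate (len + 1) (0 : ℚ)).getD k 0 = lookupVal (j :: js) [] (pos + k)
      simp [List.getD_eq_getElem?_getD, lookupVal]
  | len + 1, j :: js, v :: vs, pos, k, hinc, hge, hk => by
      rw [List.replicate_succ]
      simp only [scatterRow]
      have hjge : pos ≤ j := hge j (by simp)
      by_cases hj : j = pos
      · subst hj
        simp only [if_true]
        cases k with
        | zero => simp [lookupVal]
        | succ k =>
            rw [List.getD_cons_succ]
            have htail : ∀ x ∈ js, j + 1 ≤ x := fun x hx => lt_of_strictIncr_cons j js hinc x hx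
            rw [getD_scatter_zero len js vs (j + 1) k (strictIncr_tail hinc) htail (by omega)]
            simp only [lookupVal]
            rw [if_neg (by omega)]
            congr 1; omega
      · rw [if_neg hj]
        have hjgt : pos < j := lt_of_le_of_ne hjge (Ne.symm hj)
        cases k with
        | zero =>
            simp only [List.getD_cons_zero, Nat.add_zero]
            symm
            apply lookupVal_eq_zero_of_lt
            intro x hx
            rcases List.mem_cons.mp hx with rfl | hx'
            · exact hjgt
            · exact lt_trans hjgt (lt_of_strictIncr_cons j js hinc x hx')
        | succ k =>
            rw [List.getD_cons_succ]
            have hge' : ∀ x ∈ (j :: js), pos + 1 ≤ x := by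
              intro x hx
              rcases List.mem_cons.mp hx with rfl | hx'
              · omega
              · exact le_of_lt (lt_of_le_of_lt (by omega) (lt_of_strictIncr_cons j js hinc x hx'))
            rw [getD_scatter_zero len (j :: js) (v :: vs) (pos + 1) k hinc hge' (by omega)]
            congr 1; omega

/-- **Meaning of a densified row**: with strictly increasing columns, entry `k < n` of `densifyRow n js vs` is the value listed
for column `k`, and `0` if column `k` is not listed. -/
theorem getD_densifyRow (n : ℕ) (js : List ℕ) (vs : List ℚ) (hinc : strictIncr js = true) (k : ℕ) (hk : k < n) :
    (densifyRow n js vs).getD k 0 = lookupVal js vs k := by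
  have h := getD_scatter_zero n js vs 0 k hinc (fun x _ => Nat.zero_le x) hk
  simpa [densifyRow, densifyRowFrom] using h

/-- **Meaning of a densified piece** (matrix form): for row `i` present in both lists with strictly increasing columns,
entry `(i, j)` of `matrixOfRows n n (densify n js vs)` is the value listed for column `j` in sparse row `i` (else `0`). In
particular under `piecesWF` every piece matrix of `pieceSum` is exactly the symmetric-filled sparse matrix of the data. -/
theorem matrixOfRows_densify_apply {n : ℕ} (js : List (List ℕ)) (vs : List (List ℚ)) (i j : Fin n)
    (hi : i.val < js.length) (hi' : i.val < vs.length) (hinc : strictIncr (js.getD i.val []) = true) :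
    matrixOfRows n n (densify n js vs) i j = lookupVal (js.getD i.val []) (vs.getD i.val []) j.val := by
  simp only [matrixOfRows_apply]
  unfold densify
  rw [GramStream.getD_zipWith _ ([] : List ℕ) ([] : List ℚ) ([] : List ℚ) js vs i.val hi hi']
  exact getD_densifyRow n _ _ hinc j.val j.isLt

/-- Test: semantics on the 3×3 example. -/
example : lookupVal [0, 2] [1, 5] 2 = 5 ∧ lookupVal [0, 2] [1, 5] 1 = 0 := by decide

end Summit.NavierStokesRegularity.TurbBounds.PieceAssembly
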